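import Mathlib
import Literature.Computability.Complexity.Circuit
import Literature.Computability.Complexity.FormulaComposition
import Literature.Barriers.PneNP.NegationLimitedGapProofs
import Literature.Computability.Complexity.KWProtocol
import HarnessLib

/-!
# Karchmer–Wigderson: a protocol for the monotone game yields a monotone formula

The easy direction of the Karchmer–Wigderson theorem for the MONOTONE game (Karchmer–Wigderson
1990, Thm. `d_m(f) = C(R_f^m)`, direction `d_m(f) ≤ C(R_f^m)`; Jukna, *Boolean Function
Complexity* (2012), §3.3, Thm. 3.13, "protocol ⟹ formula"): a deterministic protocol tree
`P : KWTree ι` of depth `D` solving the monotone Karchmer–Wigderson game of `h` (on every pair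
`a ∈ h⁻¹(1)`, `b ∈ h⁻¹(0)` the players agree on a coordinate `i` with `a i = 1`, `b i = 0`,
`KWTree.SolvesMono`) yields a formula over the monotone basis `{∧₂, ∨₂}` computing `h` with at
most `2^D - 1` gates, in the tree's straight-line model `Literature.Computability.Complexity.Circuit`
(`KWTree.exists_formula_of_solvesMono`); consequently
`formulaSizeOver monotoneBasis h ≤ 2 ^ P.depth` (`KWTree.formulaSizeOver_le_two_pow_depth`).

Proof (Jukna §3.3, with the pruning of empty rectangles made explicit). By induction on the tree
one builds, for every "rectangle" `A × B` of NONEMPTY sets `A, B ⊆ {0,1}^ι` on which the protocol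
is correct (`a (P.run a b) = 1`, `b (P.run a b) = 0` for `a ∈ A`, `b ∈ B`), a clean monotone
formula that is `1` on `A`, `0` on `B` and has at most `2^depth - 1` gates
(`KWTree.exists_formula_of_rectangle`): a leaf `i` becomes the input formula `x_i`; an Alice node
splits `A = A₀ ⊔ A₁` by Alice's bit and becomes `C₀ ∨ C₁` — unless one of `A₀, A₁` is empty, in
which case the subtree of the other side alone already handles `A × B` (with an empty side nothing
would control the corresponding subformula on `B`, so empty sides must be pruned); a Bob node
dually splits `B` and becomes `C₀ ∧ C₁`. At the root `A = h⁻¹(1)`, `B = h⁻¹(0)`, and the formula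
computes `h`. If `h` is constant (one of the two sides is empty), no circuit over `{∧₂, ∨₂}`
computes `h` at all (`Circuit.eval_const_of_isOver_monotoneBasis`: such a circuit maps the all-`b`
input to `b`), so `formulaSizeOver monotoneBasis h` is the junk value `0` of the `sInf` and the
bound holds trivially (`formulaSizeOver_monotoneBasis_eq_zero_of_not_nonconst`).

## References

* [KarchmerWigderson1990] M. Karchmer, A. Wigderson, *Monotone circuits for connectivity require
  super-logarithmic depth*, SIAM J. Discrete Math. 3 (1990) 255–265, §2, Thm. (`d_m(f) = C(R_f^m)`),
  easy direction.
* [JuknaBFC2012] S. Jukna, *Boolean Function Complexity* (2012), §3.3, Thm. 3.13 (protocol trees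
  and formulas).
-/

namespace Literature.Computability.Complexity

open Circuit

variable {ι : Type*}

/-! ### No constants over the monotone basis -/

/-- A circuit over the monotone basis `{∧₂, ∨₂}` computes a NON-CONSTANT function: the computed
function is `1` at the all-ones input and `0` at the all-zeros input. [folklore] -/
theorem Circuit.nonconst_of_computes_of_isOver_monotoneBasis {C : Circuit ι}
    (hO : C.IsOver monotoneBasis) {h : (ι → Bool) → Bool} (hc : C.Computes h) :
    (∃ a, h a = true) ∧ ∃ b, h b = false :=
  ⟨⟨fun _ => true, (hc _).symm.trans (C.eval_const_of_isOver_monotoneBasis hO true)⟩,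
    ⟨fun _ => false, (hc _).symm.trans (C.eval_const_of_isOver_monotoneBasis hO false)⟩⟩

/-- Over the monotone basis `{∧₂, ∨₂}` a function that does not take both values (a constant
function, or any function on an empty variable set) has no formula, so its formula complexity
`formulaSizeOver monotoneBasis h` is the junk value `0` of the infimum. [folklore] -/
theorem formulaSizeOver_monotoneBasis_eq_zero_of_not_nonconst {h : (ι → Bool) → Bool}
    (hh : ¬ ((∃ a, h a = true) ∧ ∃ b, h b = false)) : formulaSizeOver monotoneBasis h = 0 := by
  unfold formulaSizeOver
  rw [Nat.sInf_eq_zero]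
  refine Or.inr (Set.eq_empty_of_forall_notMem ?_)
  rintro s ⟨C, hO, -, hc, -⟩
  exact hh (Circuit.nonconst_of_computes_of_isOver_monotoneBasis hO hc)

namespace KWTree

/-! ### Protocol ⟹ formula, on a rectangle -/

/-- **Karchmer–Wigderson, protocol ⟹ monotone formula, rectangle form** (the induction of
Jukna 2012, Thm. 3.13, easy direction, with empty sub-rectangles pruned). If the protocol tree `P`
is correct for the monotone game on a rectangle `A × B` with BOTH sides nonempty — on every
`a ∈ A`, `b ∈ B` it outputs a coordinate `i` with `a i = 1`, `b i = 0` — then there is a formula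
over `{∧₂, ∨₂}` (clean: its output gate is referenced by no gate) that is `1` on `A`, `0` on `B`,
with at most `2 ^ depth - 1` gates. Leaves become inputs, Alice nodes `∨`, Bob nodes `∧`; a node one
of whose sub-rectangles is empty is replaced by the subtree of the other side.
[cite: JuknaBFC2012, §3.3, Thm. 3.13 (proof, protocol ⟹ formula)]
[cite: KarchmerWigderson1990, §2, Thm. (d_m(f) = C(R_f^m)), easy direction] -/
theorem exists_formula_of_rectangle :
    ∀ (P : KWTree ι) (A B : Set (ι → Bool)), A.Nonempty → B.Nonempty →
      (∀ a ∈ A, ∀ b ∈ B, a (P.run a b) = true ∧ b (P.run a b) = false) →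
      ∃ C : Circuit ι, C.IsOver monotoneBasis ∧
        (C.IsFormula ∧ ∀ m, C.output = .inr m → C.refCount m = 0) ∧
        (∀ a ∈ A, C.eval a = true) ∧ (∀ b ∈ B, C.eval b = false) ∧
        C.size + 1 ≤ 2 ^ P.depth := by
  intro P
  induction P with
  | leaf i =>
    intro A B hA hB hrun
    obtain ⟨a₀, ha₀⟩ := hA
    obtain ⟨b₀, hb₀⟩ := hB
    refine ⟨Circuit.input i, Circuit.isOver_input _ i, Circuit.isFormula_input i, ?_, ?_, by simp⟩
    · intro a ha
      simpa using (hrun a ha b₀ hb₀).1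
    · intro b hb
      simpa using (hrun a₀ ha₀ b hb).2
  | alice s P Q ihP ihQ =>
    intro A B hA hB hrun
    -- the correctness hypothesis restricted to the two sub-rectangles `A₀ × B`, `A₁ × B`
    have hrun₀ : ∀ a ∈ A ∩ {a | s a = false}, ∀ b ∈ B,
        a (P.run a b) = true ∧ b (P.run a b) = false := by
      rintro a ⟨ha, (hs : s a = false)⟩ b hb
      simpa [hs] using hrun a ha b hb
    have hrun₁ : ∀ a ∈ A ∩ {a | s a = true}, ∀ b ∈ B,
        a (Q.run a b) = true ∧ b (Q.run a b) = false := by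
      rintro a ⟨ha, (hs : s a = true)⟩ b hb
      simpa [hs] using hrun a ha b hb
    have h1 : 2 ^ P.depth ≤ 2 ^ max P.depth Q.depth :=
      Nat.pow_le_pow_right (by norm_num) (le_max_left _ _)
    have h2 : 2 ^ Q.depth ≤ 2 ^ max P.depth Q.depth :=
      Nat.pow_le_pow_right (by norm_num) (le_max_right _ _)
    by_cases hA₀ : (A ∩ {a | s a = false}).Nonempty
    · by_cases hA₁ : (A ∩ {a | s a = true}).Nonempty
      · -- both sub-rectangles inhabited: `C₀ ∨ C₁`
        obtain ⟨C₀, hO₀, hF₀, hT₀, hf₀, hs₀⟩ := ihP _ _ hA₀ hB hrun₀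
        obtain ⟨C₁, hO₁, hF₁, hT₁, hf₁, hs₁⟩ := ihQ _ _ hA₁ hB hrun₁
        refine ⟨Circuit.binop (GateFn.or 2).2 C₀ C₁,
          Circuit.isOver_binop or_two_mem_monotoneBasis hO₀ hO₁,
          Circuit.isFormula_binop _ hF₀.1 hF₀.2 hF₁.1 hF₁.2, ?_, ?_, ?_⟩
        · intro a ha
          rw [Circuit.eval_binop, or_two_apply_pair, Bool.or_eq_true]
          cases hsa : s a
          · exact Or.inl (hT₀ a ⟨ha, hsa⟩)
          · exact Or.inr (hT₁ a ⟨ha, hsa⟩)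
        · intro b hb
          rw [Circuit.eval_binop, or_two_apply_pair, hf₀ b hb, hf₁ b hb, Bool.or_false]
        · simp only [Circuit.size_binop, depth_alice, pow_succ]
          omega
      · -- `A₁ = ∅`: Alice's bit is `0` on all of `A`, the subtree `P` handles `A × B`
        have hall : ∀ a ∈ A, s a = false := fun a ha => by
          cases hsa : s a
          · rfl
          · exact (hA₁ ⟨a, ha, hsa⟩).elim
        obtain ⟨C, hO, hF, hT, hf, hs⟩ :=
          ihP A B hA hB fun a ha b hb => hrun₀ a ⟨ha, hall a ha⟩ b hb
        refine ⟨C, hO, hF, hT, hf, ?_⟩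
        simp only [depth_alice, pow_succ]
        omega
    · -- `A₀ = ∅`: Alice's bit is `1` on all of `A`, the subtree `Q` handles `A × B`
      have hall : ∀ a ∈ A, s a = true := fun a ha => by
        cases hsa : s a
        · exact (hA₀ ⟨a, ha, hsa⟩).elim
        · rfl
      obtain ⟨C, hO, hF, hT, hf, hs⟩ :=
        ihQ A B hA hB fun a ha b hb => hrun₁ a ⟨ha, hall a ha⟩ b hb
      refine ⟨C, hO, hF, hT, hf, ?_⟩
      simp only [depth_alice, pow_succ]
      omega
  | bob s P Q ihP ihQ =>
    intro A B hA hB hrun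
    -- the correctness hypothesis restricted to the two sub-rectangles `A × B₀`, `A × B₁`
    have hrun₀ : ∀ a ∈ A, ∀ b ∈ B ∩ {b | s b = false},
        a (P.run a b) = true ∧ b (P.run a b) = false := by
      rintro a ha b ⟨hb, (hs : s b = false)⟩
      simpa [hs] using hrun a ha b hb
    have hrun₁ : ∀ a ∈ A, ∀ b ∈ B ∩ {b | s b = true},
        a (Q.run a b) = true ∧ b (Q.run a b) = false := by
      rintro a ha b ⟨hb, (hs : s b = true)⟩
      simpa [hs] using hrun a ha b hb
    have h1 : 2 ^ P.depth ≤ 2 ^ max P.depth Q.depth :=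
      Nat.pow_le_pow_right (by norm_num) (le_max_left _ _)
    have h2 : 2 ^ Q.depth ≤ 2 ^ max P.depth Q.depth :=
      Nat.pow_le_pow_right (by norm_num) (le_max_right _ _)
    by_cases hB₀ : (B ∩ {b | s b = false}).Nonempty
    · by_cases hB₁ : (B ∩ {b | s b = true}).Nonempty
      · -- both sub-rectangles inhabited: `C₀ ∧ C₁`
        obtain ⟨C₀, hO₀, hF₀, hT₀, hf₀, hs₀⟩ := ihP _ _ hA hB₀ hrun₀
        obtain ⟨C₁, hO₁, hF₁, hT₁, hf₁, hs₁⟩ := ihQ _ _ hA hB₁ hrun₁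
        refine ⟨Circuit.binop (GateFn.and 2).2 C₀ C₁,
          Circuit.isOver_binop and_two_mem_monotoneBasis hO₀ hO₁,
          Circuit.isFormula_binop _ hF₀.1 hF₀.2 hF₁.1 hF₁.2, ?_, ?_, ?_⟩
        · intro a ha
          rw [Circuit.eval_binop, and_two_apply_pair, hT₀ a ha, hT₁ a ha, Bool.and_true]
        · intro b hb
          rw [Circuit.eval_binop, and_two_apply_pair, Bool.and_eq_false_iff]
          cases hsb : s b
          · exact Or.inl (hf₀ b ⟨hb, hsb⟩)
          · exact Or.inr (hf₁ b ⟨hb, hsb⟩)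
        · simp only [Circuit.size_binop, depth_bob, pow_succ]
          omega
      · -- `B₁ = ∅`: Bob's bit is `0` on all of `B`, the subtree `P` handles `A × B`
        have hall : ∀ b ∈ B, s b = false := fun b hb => by
          cases hsb : s b
          · rfl
          · exact (hB₁ ⟨b, hb, hsb⟩).elim
        obtain ⟨C, hO, hF, hT, hf, hs⟩ :=
          ihP A B hA hB fun a ha b hb => hrun₀ a ha b ⟨hb, hall b hb⟩
        refine ⟨C, hO, hF, hT, hf, ?_⟩
        simp only [depth_bob, pow_succ]
        omega
    · -- `B₀ = ∅`: Bob's bit is `1` on all of `B`, the subtree `Q` handles `A × B`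
      have hall : ∀ b ∈ B, s b = true := fun b hb => by
        cases hsb : s b
        · exact (hB₀ ⟨b, hb, hsb⟩).elim
        · rfl
      obtain ⟨C, hO, hF, hT, hf, hs⟩ :=
        ihQ A B hA hB fun a ha b hb => hrun₁ a ha b ⟨hb, hall b hb⟩
      refine ⟨C, hO, hF, hT, hf, ?_⟩
      simp only [depth_bob, pow_succ]
      omega

/-! ### Protocol ⟹ formula -/

/-- **Karchmer–Wigderson, protocol ⟹ monotone formula** (easy direction of
`d_m(f) = C(R_f^m)`). A protocol tree of depth `D` solving the monotone Karchmer–Wigderson game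
of a function `h` taking both values yields a formula over the monotone basis `{∧₂, ∨₂}` computing
`h` with at most `2 ^ D - 1` gates.
[cite: KarchmerWigderson1990, §2, Thm. (d_m(f) = C(R_f^m)), easy direction]
[cite: JuknaBFC2012, §3.3, Thm. 3.13] -/
theorem exists_formula_of_solvesMono (P : KWTree ι) {h : (ι → Bool) → Bool}
    (hP : P.SolvesMono h) (h1 : ∃ a, h a = true) (h0 : ∃ b, h b = false) :
    ∃ C : Circuit ι, C.IsOver monotoneBasis ∧ C.IsFormula ∧ C.Computes h ∧
      C.size + 1 ≤ 2 ^ P.depth := by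
  obtain ⟨C, hO, hF, hT, hf, hs⟩ := exists_formula_of_rectangle P {a | h a = true}
    {b | h b = false} h1 h0 fun a ha b hb => hP a b ha hb
  refine ⟨C, hO, hF.1, fun x => ?_, hs⟩
  cases hx : h x
  · exact hf x hx
  · exact hT x hx

/-- **Karchmer–Wigderson, protocol depth bounds monotone formula size**: if a protocol tree `P`
solves the monotone Karchmer–Wigderson game of `h`, then
`formulaSizeOver monotoneBasis h ≤ 2 ^ P.depth`. (For `h` taking both values this is the formula
of `exists_formula_of_solvesMono`; a constant `h` — in particular any `h` on an empty variable
set — has no formula over `{∧₂, ∨₂}` and the left-hand side is the junk value `0`.)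
[cite: KarchmerWigderson1990, §2, Thm. (d_m(f) = C(R_f^m)), easy direction]
[cite: JuknaBFC2012, §3.3, Thm. 3.13] -/
theorem formulaSizeOver_le_two_pow_depth (P : KWTree ι) {h : (ι → Bool) → Bool}
    (hP : P.SolvesMono h) : formulaSizeOver monotoneBasis h ≤ 2 ^ P.depth := by
  by_cases hne : (∃ a, h a = true) ∧ ∃ b, h b = false
  · obtain ⟨C, hO, hF, hc, hs⟩ := P.exists_formula_of_solvesMono hP hne.1 hne.2
    exact (formulaSizeOver_le_of_computes C hO hF hc).trans (Nat.le_of_succ_le hs)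
  · rw [formulaSizeOver_monotoneBasis_eq_zero_of_not_nonconst hne]
    exact Nat.zero_le _

end KWTree

end Literature.Computability.Complexity
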